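import Summits.NavierStokesRegularity.NavierStokesRegularity.Theorems.RungBlowupCofinal.SolidHarmonicTransport
import Literature.Analysis.FluidPDE.HomogeneousEulerProofs
import HarnessLib

/-!
# The three-lift ansatz of a solid harmonic on the angular Galerkin ladder:
# `U = a(‖x‖²)∇φ + b(‖x‖²)φ(x)x + c(‖x‖²) x × ∇φ(x)` is a `𝒞`-eigenfield, band-limited of degree
# `j`, co-band-limited below `j`, zonal / an azimuthal wave with its scalar, and
# `div U = (2j a′ + 2ρ b′ + (j+3) b)(‖x‖²)·φ`
# (route `AngularGalerkinLadder`, crux K1 `RungBlowupCofinal`; kinematic helper, theorems only)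

Cell `ns-blowup`, seat `ns-blowup-circuit` (g11, AGL Lean seat). Helper file for
`stmt-NavierStokesRegularity-19959` serving the line `Cruxes/RungBlowupCofinal/Lines/qlwave.lean`
(card §1–§2: per rung the mean–wave system is a RADIAL boundary-value problem in the radial
coefficients of vector spherical harmonics). Continues `SolidHarmonicLifts.lean` and
`SolidHarmonicTransport.lean`. LABEL: KERNEL kinematics. Nothing here asserts a Theses declaration;
no definition, no named fact. WHAT THIS IS NOT: not Navier–Stokes evidence; not a profile — the
typing through which an explicit radial ansatz enters the letters `IsBandLimited` / `IsZonal` /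
`IsAzimuthalWave` / `IsDivFree` (profiles) and `IsCobandLimited` (defects) of
`Qlwave.IsMeanWaveProfile`; nothing about the zonal / wave EQUATIONS.

## Content

For a solid harmonic `φ` of degree `j` (`Δφ = 0`, `Dφ(y)y = jφ(y)`) and smooth radial profiles
`a, b, c : ℝ → ℝ`, `U(x) = a(‖x‖²)∇φ(x) + b(‖x‖²)φ(x)x + c(‖x‖²) x × ∇φ(x)`:

* §1 `contDiff_threeLift`; **`casimir_threeLift`** (`𝒞U = j(j+1)U`); **`isBandLimited_threeLift`**
  (`L ≥ j`); **`isCobandLimited_threeLift`** (`L < j`: `U` is `L²`-⊥ to every compactly supported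
  field band-limited of degree `≤ L` — the defect letter); **`zonal_threeLift`** (`K₂φ = 0 ⇒ J₃U = 0`);
  **`wave_threeLift`** (`K₂φ = mψ`, `K₂ψ = −mφ ⇒ J₃(J₃U) = −m²U`).
* §2 `divergence_smulSelf` (`div(φx) = Dφ(x)x + 3φ`); **`divergence_threeLift`**:
  `div U(y) = (2j·a′(ρ) + 2ρ·b′(ρ) + (j+3)·b(ρ))·φ(y)`, `ρ = ‖y‖²` (the toroidal member is solenoidal,
  `ToroidalLift`); **`isDivFree_threeLift`**: `div U = 0` under the single radial ODE
  `2j a′ + 2ρ b′ + (j+3) b = 0` on `ρ ≥ 0` coupling the two poloidal profiles.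

[cite: BullardGellman1954] (poloidal/toroidal vector spherical harmonics with radial coefficients;
the solenoidal constraint couples the two poloidal coefficients; here projection-free).
-/

noncomputable section

namespace Summit.NavierStokesRegularity.AngularGalerkinLadderSolidHarmonicAnsatz

open Set Function MeasureTheory
open scoped ContDiff RealInnerProductSpace Laplacian
open Literature.Analysis.FluidPDE
open Summit.NavierStokesRegularity.FluidComputer
open Summit.NavierStokesRegularity.FluidComputer.AngularLadder
open Summit.NavierStokesRegularity.AngularGalerkinLadderToroidalLift
open Summit.NavierStokesRegularity.AngularGalerkinLadderSolidHarmonicLifts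
open Summit.NavierStokesRegularity.AngularGalerkinLadderSolidHarmonicTransport

variable {φ ψ : EuclideanSpace ℝ (Fin 3) → ℝ} {a b c : ℝ → ℝ} {L j : ℕ}

/-- The gradient field of a smooth function is smooth. [folklore] -/
private theorem contDiff_gradient' (hφ : ContDiff ℝ ∞ φ) : ContDiff ℝ ∞ (gradient φ) := by
  set Lr : (EuclideanSpace ℝ (Fin 3) →L[ℝ] ℝ) →L[ℝ] EuclideanSpace ℝ (Fin 3) :=
    (InnerProductSpace.toDual ℝ (EuclideanSpace ℝ (Fin 3))).symm.toContinuousLinearEquiv.toContinuousLinearMap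
    with hLr
  have h1 : gradient φ = fun y => Lr (fderiv ℝ φ y) := rfl
  rw [h1]
  exact Lr.contDiff.comp (contDiff_infty_iff_fderiv.1 hφ).2

/-- `⟪D(∇φ)(x) h, w⟫ = D²φ(x)(h)(w)` for smooth `φ`. [folklore] -/
private theorem inner_fderiv_gradient_apply' (hφ : ContDiff ℝ ∞ φ) (x h w : EuclideanSpace ℝ (Fin 3)) :
    ⟪fderiv ℝ (gradient φ) x h, w⟫ = fderiv ℝ (fderiv ℝ φ) x h w := by
  set Lr : (EuclideanSpace ℝ (Fin 3) →L[ℝ] ℝ) →L[ℝ] EuclideanSpace ℝ (Fin 3) :=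
    (InnerProductSpace.toDual ℝ (EuclideanSpace ℝ (Fin 3))).symm.toContinuousLinearEquiv.toContinuousLinearMap
    with hLr
  have hLapp : ∀ l : EuclideanSpace ℝ (Fin 3) →L[ℝ] ℝ,
      Lr l = (InnerProductSpace.toDual ℝ (EuclideanSpace ℝ (Fin 3))).symm l := fun l => rfl
  have h1 : gradient φ = fun y => Lr (fderiv ℝ φ y) := rfl
  have hd : DifferentiableAt ℝ (fderiv ℝ φ) x :=
    (contDiff_infty_iff_fderiv.1 hφ).2.differentiable (by simp) x
  have h2 : HasFDerivAt (fun y => Lr (fderiv ℝ φ y)) (Lr.comp (fderiv ℝ (fderiv ℝ φ) x)) x :=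
    Lr.hasFDerivAt.comp x hd.hasFDerivAt
  rw [h1, h2.fderiv, ContinuousLinearMap.comp_apply, hLapp, InnerProductSpace.toDual_symm_apply]

/-! ## §1 The three-lift ansatz of a solid harmonic with radial profiles -/

section ThreeLift

/-- The three-lift ansatz is smooth. [folklore] -/
theorem contDiff_threeLift (ha : ContDiff ℝ ∞ a) (hb : ContDiff ℝ ∞ b) (hc : ContDiff ℝ ∞ c)
    (hφ : ContDiff ℝ ∞ φ) :
    ContDiff ℝ ∞ fun x : EuclideanSpace ℝ (Fin 3) =>
      a (‖x‖ ^ 2) • gradient φ x + b (‖x‖ ^ 2) • (φ x • x) + c (‖x‖ ^ 2) • cross x (gradient φ x) :=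
  ((contDiff_radial_smul ha (contDiff_gradient' hφ)).add
    (contDiff_radial_smul hb (contDiff_smulSelf hφ))).add
    (contDiff_radial_smul hc (contDiff_crossSelf (contDiff_gradient' hφ)))

/-- **The three-lift ansatz of a solid harmonic of degree `j` is a `𝒞`-eigenfield `j(j+1)`.**
[cite: BullardGellman1954] -/
theorem casimir_threeLift (ha : ContDiff ℝ ∞ a) (hb : ContDiff ℝ ∞ b) (hc : ContDiff ℝ ∞ c)
    (hφ : ContDiff ℝ ∞ φ) (hΔ : ∀ y, (Δ φ) y = 0) (hE : ∀ y, fderiv ℝ φ y y = (j : ℝ) * φ y) :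
    casimir (fun x : EuclideanSpace ℝ (Fin 3) =>
      a (‖x‖ ^ 2) • gradient φ x + b (‖x‖ ^ 2) • (φ x • x) + c (‖x‖ ^ 2) • cross x (gradient φ x)) =
      ((j : ℝ) * ((j : ℝ) + 1)) • fun x : EuclideanSpace ℝ (Fin 3) =>
        a (‖x‖ ^ 2) • gradient φ x + b (‖x‖ ^ 2) • (φ x • x) + c (‖x‖ ^ 2) • cross x (gradient φ x) := by
  have hG : ContDiff ℝ ∞ (gradient φ) := contDiff_gradient' hφ
  have h1 : ContDiff ℝ ∞ fun x : EuclideanSpace ℝ (Fin 3) => a (‖x‖ ^ 2) • gradient φ x :=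
    contDiff_radial_smul ha hG
  have h2 : ContDiff ℝ ∞ fun x : EuclideanSpace ℝ (Fin 3) => b (‖x‖ ^ 2) • (φ x • x) :=
    contDiff_radial_smul hb (contDiff_smulSelf hφ)
  have h3 : ContDiff ℝ ∞ fun x : EuclideanSpace ℝ (Fin 3) => c (‖x‖ ^ 2) • cross x (gradient φ x) :=
    contDiff_radial_smul hc (contDiff_crossSelf hG)
  have c1 := casimir_radial_smul_of_eq_smul ha hG (casimir_gradient_of_solidHarmonic hφ hΔ hE)
  have c2 := casimir_radial_smul_of_eq_smul hb (contDiff_smulSelf hφ)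
    (casimir_smulSelf_of_solidHarmonic hφ hΔ hE)
  have c3 := casimir_radial_smul_of_eq_smul hc (contDiff_crossSelf hG)
    (casimir_crossSelf_gradient_of_solidHarmonic hφ hΔ hE)
  have e : (fun x : EuclideanSpace ℝ (Fin 3) => a (‖x‖ ^ 2) • gradient φ x + b (‖x‖ ^ 2) • (φ x • x) +
      c (‖x‖ ^ 2) • cross x (gradient φ x)) =
      (fun x : EuclideanSpace ℝ (Fin 3) => a (‖x‖ ^ 2) • gradient φ x) +
        (fun x : EuclideanSpace ℝ (Fin 3) => b (‖x‖ ^ 2) • (φ x • x)) +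
        fun x : EuclideanSpace ℝ (Fin 3) => c (‖x‖ ^ 2) • cross x (gradient φ x) := rfl
  have h12 : ContDiff ℝ ∞ ((fun x : EuclideanSpace ℝ (Fin 3) => a (‖x‖ ^ 2) • gradient φ x) + (fun x : EuclideanSpace ℝ (Fin 3) => b (‖x‖ ^ 2) • (φ x • x))) := h1.add h2
  rw [e, casimir_add h12 h3, casimir_add h1 h2, c1, c2, c3, smul_add, smul_add]

/-- **The three-lift ansatz of a solid harmonic of degree `j` is band-limited of every degree
`L ≥ j`** (letters `IsBandLimited L V`, `IsBandLimited L W`). [cite: BullardGellman1954] -/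
theorem isBandLimited_threeLift (ha : ContDiff ℝ ∞ a) (hb : ContDiff ℝ ∞ b) (hc : ContDiff ℝ ∞ c)
    (hφ : ContDiff ℝ ∞ φ) (hΔ : ∀ y, (Δ φ) y = 0) (hE : ∀ y, fderiv ℝ φ y y = (j : ℝ) * φ y)
    (hjL : j ≤ L) :
    IsBandLimited L fun x : EuclideanSpace ℝ (Fin 3) =>
      a (‖x‖ ^ 2) • gradient φ x + b (‖x‖ ^ 2) • (φ x • x) + c (‖x‖ ^ 2) • cross x (gradient φ x) :=
  isBandLimited_of_casimir_eq_smul (contDiff_threeLift ha hb hc hφ)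
    (casimir_threeLift ha hb hc hφ hΔ hE) hjL

/-- **Below its degree the three-lift ansatz is CO-band-limited**: for `L < j` it is `L²`-orthogonal
to every compactly supported field band-limited of degree `≤ L` (letter `IsCobandLimited L E` of the
defects). [cite: BullardGellman1954] -/
theorem isCobandLimited_threeLift (ha : ContDiff ℝ ∞ a) (hb : ContDiff ℝ ∞ b) (hc : ContDiff ℝ ∞ c)
    (hφ : ContDiff ℝ ∞ φ) (hΔ : ∀ y, (Δ φ) y = 0) (hE : ∀ y, fderiv ℝ φ y y = (j : ℝ) * φ y)
    (hLj : L < j) :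
    IsCobandLimited L fun x : EuclideanSpace ℝ (Fin 3) =>
      a (‖x‖ ^ 2) • gradient φ x + b (‖x‖ ^ 2) • (φ x • x) + c (‖x‖ ^ 2) • cross x (gradient φ x) :=
  isCobandLimited_of_casimir_eq_smul_of_lt (contDiff_threeLift ha hb hc hφ)
    (casimir_threeLift ha hb hc hφ hΔ hE) hLj

/-- **Zonal scalar, zonal ansatz**: if `K₂φ = 0` the three-lift ansatz is zonal, `J₃U = 0` (letter
`Qlwave.IsZonal`). [folklore] -/
theorem zonal_threeLift (ha : ContDiff ℝ ∞ a) (hb : ContDiff ℝ ∞ b) (hc : ContDiff ℝ ∞ c)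
    (hφ : ContDiff ℝ ∞ φ) (hz : ∀ y, -fderiv ℝ φ y (crossCLM (axis 2) y) = 0)
    (y : EuclideanSpace ℝ (Fin 3)) :
    angGen 2 (fun x : EuclideanSpace ℝ (Fin 3) =>
      a (‖x‖ ^ 2) • gradient φ x + b (‖x‖ ^ 2) • (φ x • x) + c (‖x‖ ^ 2) • cross x (gradient φ x)) y = 0 := by
  have hφd : Differentiable ℝ φ := hφ.differentiable (by simp)
  have hG : ContDiff ℝ ∞ (gradient φ) := contDiff_gradient' hφ
  have hGd : Differentiable ℝ (gradient φ) := hG.differentiable (by simp)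
  have hSd : Differentiable ℝ fun x : EuclideanSpace ℝ (Fin 3) => φ x • x :=
    (contDiff_smulSelf hφ).differentiable (by simp)
  have hTd : Differentiable ℝ fun x => cross x (gradient φ x) :=
    (contDiff_crossSelf hG).differentiable (by simp)
  have had := (ha.differentiable (by simp) : Differentiable ℝ a)
  have hbd := (hb.differentiable (by simp) : Differentiable ℝ b)
  have hcd := (hc.differentiable (by simp) : Differentiable ℝ c)
  have h1d : Differentiable ℝ fun x : EuclideanSpace ℝ (Fin 3) => a (‖x‖ ^ 2) • gradient φ x :=
    (contDiff_radial_smul ha hG).differentiable (by simp)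
  have h2d : Differentiable ℝ fun x : EuclideanSpace ℝ (Fin 3) => b (‖x‖ ^ 2) • (φ x • x) :=
    (contDiff_radial_smul hb (contDiff_smulSelf hφ)).differentiable (by simp)
  have h3d : Differentiable ℝ fun x : EuclideanSpace ℝ (Fin 3) => c (‖x‖ ^ 2) • cross x (gradient φ x) :=
    (contDiff_radial_smul hc (contDiff_crossSelf hG)).differentiable (by simp)
  have e : (fun x : EuclideanSpace ℝ (Fin 3) => a (‖x‖ ^ 2) • gradient φ x + b (‖x‖ ^ 2) • (φ x • x) +
      c (‖x‖ ^ 2) • cross x (gradient φ x)) =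
      (fun x : EuclideanSpace ℝ (Fin 3) => a (‖x‖ ^ 2) • gradient φ x) +
        (fun x : EuclideanSpace ℝ (Fin 3) => b (‖x‖ ^ 2) • (φ x • x)) +
        fun x : EuclideanSpace ℝ (Fin 3) => c (‖x‖ ^ 2) • cross x (gradient φ x) := rfl
  have h12d : Differentiable ℝ ((fun x : EuclideanSpace ℝ (Fin 3) => a (‖x‖ ^ 2) • gradient φ x) + (fun x : EuclideanSpace ℝ (Fin 3) => b (‖x‖ ^ 2) • (φ x • x))) := h1d.add h2d
  rw [e, angGen_add h12d h3d 2, angGen_add h1d h2d 2]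
  simp only [Pi.add_apply, angGen_radial_smul had hGd 2, angGen_radial_smul hbd hSd 2,
    angGen_radial_smul hcd hTd 2, angGen_two_gradient_of_zonal hφ hz y,
    angGen_two_smulSelf_of_zonal hφd hz y, angGen_two_crossSelf_gradient_of_zonal hφ hz y,
    smul_zero, add_zero]

/-- **Wave pair, wave ansatz**: if `K₂φ = mψ` and `K₂ψ = −mφ` (e.g. `φ, ψ = Re, Im (y₀+iy₁)^m`)
the three-lift ansatz of `φ` is an `m`-fold azimuthal wave, `J₃(J₃U) = −m²U` (letter
`Qlwave.IsAzimuthalWave m U`). [folklore] -/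
theorem wave_threeLift (ha : ContDiff ℝ ∞ a) (hb : ContDiff ℝ ∞ b) (hc : ContDiff ℝ ∞ c)
    (hφ : ContDiff ℝ ∞ φ) (hψ : ContDiff ℝ ∞ ψ) {m : ℝ}
    (h1 : ∀ y, -fderiv ℝ φ y (crossCLM (axis 2) y) = m * ψ y)
    (h2 : ∀ y, -fderiv ℝ ψ y (crossCLM (axis 2) y) = -m * φ y) (y : EuclideanSpace ℝ (Fin 3)) :
    angGen 2 (angGen 2 fun x : EuclideanSpace ℝ (Fin 3) =>
      a (‖x‖ ^ 2) • gradient φ x + b (‖x‖ ^ 2) • (φ x • x) + c (‖x‖ ^ 2) • cross x (gradient φ x)) y =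
      -((m ^ 2) • (a (‖y‖ ^ 2) • gradient φ y + b (‖y‖ ^ 2) • (φ y • y) +
        c (‖y‖ ^ 2) • cross y (gradient φ y))) := by
  have hG : ContDiff ℝ ∞ (gradient φ) := contDiff_gradient' hφ
  have hS : ContDiff ℝ ∞ fun x : EuclideanSpace ℝ (Fin 3) => φ x • x := contDiff_smulSelf hφ
  have hT : ContDiff ℝ ∞ fun x => cross x (gradient φ x) := contDiff_crossSelf hG
  have had := (ha.differentiable (by simp) : Differentiable ℝ a)
  have hbd := (hb.differentiable (by simp) : Differentiable ℝ b)
  have hcd := (hc.differentiable (by simp) : Differentiable ℝ c)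
  have hf1 : ContDiff ℝ ∞ fun x : EuclideanSpace ℝ (Fin 3) => a (‖x‖ ^ 2) • gradient φ x :=
    contDiff_radial_smul ha hG
  have hf2 : ContDiff ℝ ∞ fun x : EuclideanSpace ℝ (Fin 3) => b (‖x‖ ^ 2) • (φ x • x) :=
    contDiff_radial_smul hb hS
  have hf3 : ContDiff ℝ ∞ fun x : EuclideanSpace ℝ (Fin 3) => c (‖x‖ ^ 2) • cross x (gradient φ x) :=
    contDiff_radial_smul hc hT
  -- `J₃²` of each radially cut-off lift
  have w1 : ∀ z, angGen 2 (angGen 2 fun x : EuclideanSpace ℝ (Fin 3) => a (‖x‖ ^ 2) • gradient φ x) z =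
      -((m ^ 2) • (a (‖z‖ ^ 2) • gradient φ z)) := fun z => by
    rw [angGen_radial_smul had (hG.differentiable (by simp)) 2,
      angGen_radial_smul had ((contDiff_angGen hG 2).differentiable (by simp)) 2]
    simp only [wave_gradient hφ hψ h1 h2 z, smul_neg, smul_comm (a (‖z‖ ^ 2))]
  have w2 : ∀ z, angGen 2 (angGen 2 fun x : EuclideanSpace ℝ (Fin 3) => b (‖x‖ ^ 2) • (φ x • x)) z =
      -((m ^ 2) • (b (‖z‖ ^ 2) • (φ z • z))) := fun z => by
    rw [angGen_radial_smul hbd (hS.differentiable (by simp)) 2,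
      angGen_radial_smul hbd ((contDiff_angGen hS 2).differentiable (by simp)) 2]
    simp only [wave_smulSelf hφ hψ h1 h2 z, smul_neg, smul_comm (b (‖z‖ ^ 2))]
  have w3 : ∀ z, angGen 2 (angGen 2 fun x : EuclideanSpace ℝ (Fin 3) =>
      c (‖x‖ ^ 2) • cross x (gradient φ x)) z = -((m ^ 2) • (c (‖z‖ ^ 2) • cross z (gradient φ z))) :=
    fun z => by
    rw [angGen_radial_smul hcd (hT.differentiable (by simp)) 2,
      angGen_radial_smul hcd ((contDiff_angGen hT 2).differentiable (by simp)) 2]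
    simp only [wave_crossSelf_gradient hφ hψ h1 h2 z, smul_neg, smul_comm (c (‖z‖ ^ 2))]
  have e : (fun x : EuclideanSpace ℝ (Fin 3) => a (‖x‖ ^ 2) • gradient φ x + b (‖x‖ ^ 2) • (φ x • x) +
      c (‖x‖ ^ 2) • cross x (gradient φ x)) =
      (fun x : EuclideanSpace ℝ (Fin 3) => a (‖x‖ ^ 2) • gradient φ x) +
        (fun x : EuclideanSpace ℝ (Fin 3) => b (‖x‖ ^ 2) • (φ x • x)) +
        fun x : EuclideanSpace ℝ (Fin 3) => c (‖x‖ ^ 2) • cross x (gradient φ x) := rfl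
  have d1 := hf1.differentiable (by simp)
  have d2 := hf2.differentiable (by simp)
  have d3 := hf3.differentiable (by simp)
  have dJ1 := (contDiff_angGen hf1 2).differentiable (by simp)
  have dJ2 := (contDiff_angGen hf2 2).differentiable (by simp)
  have dJ3 := (contDiff_angGen hf3 2).differentiable (by simp)
  have d12 : Differentiable ℝ ((fun x : EuclideanSpace ℝ (Fin 3) => a (‖x‖ ^ 2) • gradient φ x) + (fun x : EuclideanSpace ℝ (Fin 3) => b (‖x‖ ^ 2) • (φ x • x))) := d1.add d2
  have dJ12 : Differentiable ℝ (angGen 2 (fun x : EuclideanSpace ℝ (Fin 3) => a (‖x‖ ^ 2) • gradient φ x) + angGen 2 (fun x : EuclideanSpace ℝ (Fin 3) => b (‖x‖ ^ 2) • (φ x • x))) := dJ1.add dJ2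
  rw [e, angGen_add d12 d3 2, angGen_add d1 d2 2, angGen_add dJ12 dJ3 2, angGen_add dJ1 dJ2 2]
  simp only [Pi.add_apply, w1 y, w2 y, w3 y, smul_add, neg_add]

end ThreeLift

/-! ## §2 The divergence of the three-lift ansatz -/

section Divergence

/-- `div ∇φ = Δφ`. [folklore] -/
private theorem divergence_gradient' (hφ : ContDiff ℝ ∞ φ) (y : EuclideanSpace ℝ (Fin 3)) :
    VectorCalculus.divergence (gradient φ) y = (Δ φ) y := by
  rw [divergence_eq_sum_inner_fderiv (EuclideanSpace.basisFun (Fin 3) ℝ),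
    InnerProductSpace.laplacian_eq_iteratedFDeriv_orthonormalBasis φ (EuclideanSpace.basisFun (Fin 3) ℝ)]
  refine Finset.sum_congr rfl fun i _ => ?_
  rw [iteratedFDeriv_two_apply, real_inner_comm, inner_fderiv_gradient_apply' hφ]
  simp

/-- `div (x ↦ x) = 3` on `ℝ³`. [folklore] -/
private theorem divergence_id (y : EuclideanSpace ℝ (Fin 3)) :
    VectorCalculus.divergence (fun x : EuclideanSpace ℝ (Fin 3) => x) y = 3 := by
  rw [divergence_eq_sum_inner_fderiv (EuclideanSpace.basisFun (Fin 3) ℝ)]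
  have h : fderiv ℝ (fun x : EuclideanSpace ℝ (Fin 3) => x) y = ContinuousLinearMap.id ℝ _ := fderiv_id
  simp only [h, ContinuousLinearMap.coe_id', id, real_inner_self_eq_norm_sq,
    (EuclideanSpace.basisFun (Fin 3) ℝ).orthonormal.1, one_pow, Finset.sum_const, Finset.card_univ,
    Fintype.card_fin, nsmul_eq_mul, Nat.cast_ofNat, mul_one]

/-- `div (φ x) = Dφ(x) x + 3 φ(x)`. [folklore] -/
theorem divergence_smulSelf (hφ : Differentiable ℝ φ) (y : EuclideanSpace ℝ (Fin 3)) :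
    VectorCalculus.divergence (fun x : EuclideanSpace ℝ (Fin 3) => φ x • x) y = fderiv ℝ φ y y + 3 * φ y := by
  have hid : DifferentiableAt ℝ (fun x : EuclideanSpace ℝ (Fin 3) => x) y := differentiableAt_fun_id
  rw [Shvydkoy2018.divergence_smul_apply (EuclideanSpace.basisFun (Fin 3) ℝ) (hφ y) hid, divergence_id]
  ring

/-- The derivative of a radial profile: `D(a(‖·‖²))(y) w = a′(‖y‖²) · 2⟪y, w⟫`. [folklore] -/
private theorem fderiv_radial_apply (ha : Differentiable ℝ a) (y w : EuclideanSpace ℝ (Fin 3)) :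
    fderiv ℝ (fun x : EuclideanSpace ℝ (Fin 3) => a (‖x‖ ^ 2)) y w = deriv a (‖y‖ ^ 2) * (2 * ⟪y, w⟫) := by
  have h : HasFDerivAt (fun x : EuclideanSpace ℝ (Fin 3) => a (‖x‖ ^ 2))
      (deriv a (‖y‖ ^ 2) • (2 : ℕ) • innerSL ℝ y) y :=
    ((ha (‖y‖ ^ 2)).hasDerivAt).comp_hasFDerivAt y (hasStrictFDerivAt_norm_sq y).hasFDerivAt
  rw [h.fderiv]
  simp

/-- Divergence is additive on differentiable fields. [folklore] -/
private theorem divergence_add' {f g : EuclideanSpace ℝ (Fin 3) → EuclideanSpace ℝ (Fin 3)}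
    {y : EuclideanSpace ℝ (Fin 3)} (hf : DifferentiableAt ℝ f y) (hg : DifferentiableAt ℝ g y) :
    VectorCalculus.divergence (f + g) y = VectorCalculus.divergence f y + VectorCalculus.divergence g y := by
  simp only [VectorCalculus.divergence, fderiv_add hf hg, ContinuousLinearMap.toLinearMap_add, map_add]

/-- **The divergence of the three-lift ansatz of a solid harmonic of degree `j`**:
`div U(y) = (2j a′(‖y‖²) + 2‖y‖² b′(‖y‖²) + (j+3) b(‖y‖²)) φ(y)` — the gradient member contributes
`2a′ Dφ(y)y = 2j a′ φ`, the radial member `b(Dφ(y)y + 3φ) + 2‖y‖² b′ φ`, the toroidal member nothing.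
[cite: BullardGellman1954] -/
theorem divergence_threeLift (ha : ContDiff ℝ ∞ a) (hb : ContDiff ℝ ∞ b) (hc : ContDiff ℝ ∞ c)
    (hφ : ContDiff ℝ ∞ φ) (hΔ : ∀ y, (Δ φ) y = 0) (hE : ∀ y, fderiv ℝ φ y y = (j : ℝ) * φ y)
    (y : EuclideanSpace ℝ (Fin 3)) :
    VectorCalculus.divergence (fun x : EuclideanSpace ℝ (Fin 3) =>
      a (‖x‖ ^ 2) • gradient φ x + b (‖x‖ ^ 2) • (φ x • x) + c (‖x‖ ^ 2) • cross x (gradient φ x)) y =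
      (2 * (j : ℝ) * deriv a (‖y‖ ^ 2) + 2 * ‖y‖ ^ 2 * deriv b (‖y‖ ^ 2) +
        ((j : ℝ) + 3) * b (‖y‖ ^ 2)) * φ y := by
  have hφd : Differentiable ℝ φ := hφ.differentiable (by simp)
  have hG : ContDiff ℝ ∞ (gradient φ) := contDiff_gradient' hφ
  have hS : ContDiff ℝ ∞ fun x : EuclideanSpace ℝ (Fin 3) => φ x • x := contDiff_smulSelf hφ
  have hT : ContDiff ℝ ∞ fun x => cross x (gradient φ x) := contDiff_crossSelf hG
  have had : Differentiable ℝ a := ha.differentiable (by simp)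
  have hbd : Differentiable ℝ b := hb.differentiable (by simp)
  have hcd : Differentiable ℝ c := hc.differentiable (by simp)
  have hn : Differentiable ℝ fun x : EuclideanSpace ℝ (Fin 3) => ‖x‖ ^ 2 :=
    (contDiff_norm_sq ℝ (n := 1)).differentiable one_ne_zero
  have hf1 : ContDiff ℝ ∞ fun x : EuclideanSpace ℝ (Fin 3) => a (‖x‖ ^ 2) • gradient φ x :=
    contDiff_radial_smul ha hG
  have hf2 : ContDiff ℝ ∞ fun x : EuclideanSpace ℝ (Fin 3) => b (‖x‖ ^ 2) • (φ x • x) :=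
    contDiff_radial_smul hb hS
  have hf3 : ContDiff ℝ ∞ fun x : EuclideanSpace ℝ (Fin 3) => c (‖x‖ ^ 2) • cross x (gradient φ x) :=
    contDiff_radial_smul hc hT
  have e : (fun x : EuclideanSpace ℝ (Fin 3) => a (‖x‖ ^ 2) • gradient φ x + b (‖x‖ ^ 2) • (φ x • x) +
      c (‖x‖ ^ 2) • cross x (gradient φ x)) =
      (fun x : EuclideanSpace ℝ (Fin 3) => a (‖x‖ ^ 2) • gradient φ x) +
        (fun x : EuclideanSpace ℝ (Fin 3) => b (‖x‖ ^ 2) • (φ x • x)) +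
        fun x : EuclideanSpace ℝ (Fin 3) => c (‖x‖ ^ 2) • cross x (gradient φ x) := rfl
  have d1 : VectorCalculus.divergence (fun x : EuclideanSpace ℝ (Fin 3) => a (‖x‖ ^ 2) • gradient φ x) y
      = 2 * (j : ℝ) * deriv a (‖y‖ ^ 2) * φ y := by
    have hca : DifferentiableAt ℝ (fun x : EuclideanSpace ℝ (Fin 3) => a (‖x‖ ^ 2)) y := (had.comp hn) y
    rw [Shvydkoy2018.divergence_smul_apply (EuclideanSpace.basisFun (Fin 3) ℝ) hca
      ((hG.differentiable (by simp)) y), divergence_gradient' hφ, hΔ y, mul_zero, zero_add,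
      fderiv_radial_apply had, real_inner_comm, inner_gradient_left, hE y]
    ring
  have d2 : VectorCalculus.divergence (fun x : EuclideanSpace ℝ (Fin 3) => b (‖x‖ ^ 2) • (φ x • x)) y
      = (2 * ‖y‖ ^ 2 * deriv b (‖y‖ ^ 2) + ((j : ℝ) + 3) * b (‖y‖ ^ 2)) * φ y := by
    have hcb : DifferentiableAt ℝ (fun x : EuclideanSpace ℝ (Fin 3) => b (‖x‖ ^ 2)) y := (hbd.comp hn) y
    rw [Shvydkoy2018.divergence_smul_apply (EuclideanSpace.basisFun (Fin 3) ℝ) hcb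
      ((hS.differentiable (by simp)) y), divergence_smulSelf hφd, hE y, fderiv_radial_apply hbd,
      inner_smul_right, real_inner_self_eq_norm_sq]
    ring
  have d3 : VectorCalculus.divergence (fun x : EuclideanSpace ℝ (Fin 3) =>
      c (‖x‖ ^ 2) • cross x (gradient φ x)) y = 0 :=
    isDivFree_radial_crossSelf_gradient hcd hφ y
  have hf12 : ContDiff ℝ ∞ ((fun x : EuclideanSpace ℝ (Fin 3) => a (‖x‖ ^ 2) • gradient φ x) + (fun x : EuclideanSpace ℝ (Fin 3) => b (‖x‖ ^ 2) • (φ x • x))) := hf1.add hf2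
  rw [e, divergence_add' ((hf12.differentiable (by simp)) y) ((hf3.differentiable (by simp)) y),
    divergence_add' ((hf1.differentiable (by simp)) y) ((hf2.differentiable (by simp)) y), d1, d2, d3]
  ring

/-- **The three-lift ansatz is divergence free iff the two poloidal profiles obey ONE radial ODE**
(sufficiency): if `2j a′(ρ) + 2ρ b′(ρ) + (j+3) b(ρ) = 0` for all `ρ ≥ 0` then `div U = 0` (letters
`IsDivFree V`, `IsDivFree W`). [cite: BullardGellman1954] -/
theorem isDivFree_threeLift (ha : ContDiff ℝ ∞ a) (hb : ContDiff ℝ ∞ b) (hc : ContDiff ℝ ∞ c)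
    (hφ : ContDiff ℝ ∞ φ) (hΔ : ∀ y, (Δ φ) y = 0) (hE : ∀ y, fderiv ℝ φ y y = (j : ℝ) * φ y)
    (hODE : ∀ ρ : ℝ, 0 ≤ ρ → 2 * (j : ℝ) * deriv a ρ + 2 * ρ * deriv b ρ + ((j : ℝ) + 3) * b ρ = 0) :
    VectorCalculus.IsDivFree fun x : EuclideanSpace ℝ (Fin 3) =>
      a (‖x‖ ^ 2) • gradient φ x + b (‖x‖ ^ 2) • (φ x • x) + c (‖x‖ ^ 2) • cross x (gradient φ x) := by
  intro y
  rw [divergence_threeLift ha hb hc hφ hΔ hE y, hODE _ (sq_nonneg _), zero_mul]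

end Divergence

end Summit.NavierStokesRegularity.AngularGalerkinLadderSolidHarmonicAnsatz

end
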